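import Mathlib
import HarnessLib

/-! # Crux `PercNearOneGluing.AdditiveGluing` (stmt-CriticalPhenomena-4576) — AL5 for every block and every relay set,
# part B: the LAYER-CAKE lemma and the abstract transfer step

Support file (`--supports stmt-CriticalPhenomena-4576`; task png-dp-al5, gen 2); no definitions, no named facts; pure finite
real arithmetic (no percolation), used by parts C–D.

* `al5lc_layerCake` — if `λ ≥ 0` on a finite index set `P` and every upper level set `{K ∈ P | c ≤ λ K}` (`c > 0`) has
  `Σ z ≥ 0`, then `Σ_{K∈P} λ K · z K ≥ 0` (discrete layer cake / Abel summation: peel off the smallest positive level).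
* `al5lc_transfer_abstract` — the transfer step behind "gluing an edge at the bystander preserves all up-set inequalities":
  patterns are the subsets `K ⊆ F`; given `z` (un-glued pattern terms), `g` (glued pattern terms), masses `ν ≥ ν₁ ≥ 0` with
  `ν` antitone, the quantitative transfer `ν₁ z ≤ ν g`, the monotonicity `ν₁(K) ν(K') ≤ ν₁(K') ν(K)` for `K ⊆ K'`, and
  nonnegativity of `Σ z` over every up-closed family of nonempty patterns, one gets
  `0 ≤ Σ_{𝒰₀} z + p · Σ_{𝒰₁∖𝒰₀} g` for up-closed families `𝒰₀ ⊆ 𝒰₁` of nonempty patterns and `p ∈ [0,1]`.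
  (The weight `λ = 1` on `𝒰₀`, `p ν₁/ν` on `𝒰₁ ∖ 𝒰₀`, `0` elsewhere is monotone, and `al5lc_layerCake` applies.)
[folklore; the probabilistic inputs are in `…AL5QTransfer.lean`]
-/

namespace Summit.CriticalPhenomena.PercolationContinuityZ3.Theorems

noncomputable section
open Classical

section AL5LayerCake

open Finset

variable {ι : Type*}

/-- **Discrete layer cake.**  `P` a finite index set, `λ ≥ 0` on `P`, and for every `c > 0` the upper level set
`{K ∈ P | c ≤ λ K}` carries a nonnegative `z`-sum; then `Σ_{K ∈ P} λ K · z K ≥ 0`. [folklore] -/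
theorem al5lc_layerCake (P : Finset ι) (z : ι → ℝ) :
    ∀ (lam : ι → ℝ), (∀ K ∈ P, 0 ≤ lam K) →
      (∀ c : ℝ, 0 < c → 0 ≤ ∑ K ∈ P.filter (fun K => c ≤ lam K), z K) →
      0 ≤ ∑ K ∈ P, lam K * z K := by
  -- strong induction on the number of indices with positive weight
  suffices h : ∀ (m : ℕ) (lam : ι → ℝ), (P.filter (fun K => 0 < lam K)).card ≤ m → (∀ K ∈ P, 0 ≤ lam K) →
      (∀ c : ℝ, 0 < c → 0 ≤ ∑ K ∈ P.filter (fun K => c ≤ lam K), z K) → 0 ≤ ∑ K ∈ P, lam K * z K from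
    fun lam h0 hlev => h _ lam le_rfl h0 hlev
  intro m
  induction m with
  | zero =>
    intro lam hcard h0 _
    have hempty := Finset.card_eq_zero.1 (Nat.le_zero.1 hcard)
    have hzero : ∀ K ∈ P, lam K = 0 := by
      intro K hK
      have hnot : ¬ 0 < lam K := fun hpos => by
        have hmem : K ∈ P.filter (fun K => 0 < lam K) := Finset.mem_filter.2 ⟨hK, hpos⟩
        rw [hempty] at hmem
        exact Finset.notMem_empty K hmem
      exact le_antisymm (not_lt.1 hnot) (h0 K hK)
    rw [Finset.sum_eq_zero fun K hK => by rw [hzero K hK, zero_mul]]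
  | succ m ih =>
    intro lam hcard h0 hlev
    by_cases hpos : (P.filter (fun K => 0 < lam K)).Nonempty
    swap
    · rw [Finset.not_nonempty_iff_eq_empty] at hpos
      exact ih lam (by rw [hpos, Finset.card_empty]; exact Nat.zero_le _) h0 hlev
    -- the smallest positive weight
    obtain ⟨K₀, hK₀S, hmin⟩ := (P.filter (fun K => 0 < lam K)).exists_min_image lam hpos
    set c₀ : ℝ := lam K₀ with hc₀def
    have hc₀ : 0 < c₀ := (Finset.mem_filter.1 hK₀S).2
    have hmin' : ∀ K ∈ P, 0 < lam K → c₀ ≤ lam K := fun K hK hp => hmin K (Finset.mem_filter.2 ⟨hK, hp⟩)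
    -- peel off the level `c₀`
    set lam' : ι → ℝ := fun K => if c₀ ≤ lam K then lam K - c₀ else lam K with hlam'
    have hdecomp : ∑ K ∈ P, lam K * z K =
        c₀ * (∑ K ∈ P.filter (fun K => c₀ ≤ lam K), z K) + ∑ K ∈ P, lam' K * z K := by
      rw [Finset.sum_filter, Finset.mul_sum, ← Finset.sum_add_distrib]
      refine Finset.sum_congr rfl fun K _ => ?_
      by_cases h : c₀ ≤ lam K
      · simp only [hlam', h, if_true]; ring
      · simp only [hlam', h, if_false]; ring
    rw [hdecomp]
    refine add_nonneg (mul_nonneg hc₀.le (hlev c₀ hc₀)) (ih lam' ?_ ?_ ?_)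
    · have hsub : P.filter (fun K => 0 < lam' K) ⊆ (P.filter (fun K => 0 < lam K)).erase K₀ := by
        intro K hK
        obtain ⟨hKP, hKpos⟩ := Finset.mem_filter.1 hK
        rw [Finset.mem_erase]
        refine ⟨?_, Finset.mem_filter.2 ⟨hKP, ?_⟩⟩
        · rintro rfl
          have hle : c₀ ≤ lam K := le_of_eq hc₀def
          simp only [hlam', hle, if_true] at hKpos
          rw [hc₀def, sub_self] at hKpos
          exact lt_irrefl _ hKpos
        · by_cases h : c₀ ≤ lam K
          · exact lt_of_lt_of_le hc₀ h
          · simp only [hlam', h, if_false] at hKpos; exact hKpos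
      have h1 := Finset.card_le_card hsub
      rw [Finset.card_erase_of_mem hK₀S] at h1
      have hSpos : 0 < (P.filter (fun K => 0 < lam K)).card := Finset.card_pos.2 hpos
      omega
    · intro K hK
      by_cases h : c₀ ≤ lam K
      · simp only [hlam', h, if_true]; linarith
      · simp only [hlam', h, if_false]; exact h0 K hK
    · intro c hc
      have hset : P.filter (fun K => c ≤ lam' K) = P.filter (fun K => c + c₀ ≤ lam K) := by
        refine Finset.filter_congr fun K hK => ?_
        by_cases h : c₀ ≤ lam K
        · simp only [hlam', h, if_true]
          constructor <;> intro <;> linarith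
        · simp only [hlam', h, if_false]
          have hK0 : lam K = 0 := by
            by_contra hne
            exact h (hmin' K hK (lt_of_le_of_ne (h0 K hK) (Ne.symm hne)))
          rw [hK0]
          constructor <;> intro <;> linarith
      rw [hset]
      exact hlev (c + c₀) (by linarith)

variable {α : Type*} [DecidableEq α]

/-- **Abstract transfer step** (see the module docstring): from the un-glued up-set inequalities to the mixed inequality
`0 ≤ Σ_{K∈𝒰₀} z K + p · Σ_{K ∈ 𝒰₁∖𝒰₀} g K`. [folklore] -/
theorem al5lc_transfer_abstract (F : Finset α) (z g ν ν₁ : Finset α → ℝ)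
    (hν₁_nonneg : ∀ K, K ⊆ F → 0 ≤ ν₁ K) (hν₁_le : ∀ K, K ⊆ F → ν₁ K ≤ ν K)
    (hν_anti : ∀ K K', K ⊆ K' → K' ⊆ F → ν K' ≤ ν K)
    (hq : ∀ K, K ⊆ F → ν₁ K * z K ≤ ν K * g K)
    (hz0 : ∀ K, K ⊆ F → ν K = 0 → z K = 0) (hg0 : ∀ K, K ⊆ F → ν₁ K = 0 → g K = 0)
    (hmono : ∀ K K', K ⊆ K' → K' ⊆ F → ν₁ K * ν K' ≤ ν₁ K' * ν K)
    (hUPS : ∀ 𝒱 : Finset (Finset α), 𝒱 ⊆ F.powerset → (∀ K ∈ 𝒱, K.Nonempty) →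
      (∀ K ∈ 𝒱, ∀ K', K ⊆ K' → K' ⊆ F → K' ∈ 𝒱) → 0 ≤ ∑ K ∈ 𝒱, z K)
    (𝒰₀ 𝒰₁ : Finset (Finset α)) (h01 : 𝒰₀ ⊆ 𝒰₁) (h1F : 𝒰₁ ⊆ F.powerset) (hne : ∀ K ∈ 𝒰₁, K.Nonempty)
    (hup0 : ∀ K ∈ 𝒰₀, ∀ K', K ⊆ K' → K' ⊆ F → K' ∈ 𝒰₀)
    (hup1 : ∀ K ∈ 𝒰₁, ∀ K', K ⊆ K' → K' ⊆ F → K' ∈ 𝒰₁)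
    (p : ℝ) (hp0 : 0 ≤ p) (hp1 : p ≤ 1) :
    0 ≤ ∑ K ∈ 𝒰₀, z K + p * ∑ K ∈ 𝒰₁ \ 𝒰₀, g K := by
  -- the transfer factor
  set κ : Finset α → ℝ := fun K => if ν K = 0 then 1 else ν₁ K / ν K with hκ
  have hνpos : ∀ K, K ⊆ F → ν K ≠ 0 → 0 < ν K := fun K hK h =>
    lt_of_le_of_ne ((hν₁_nonneg K hK).trans (hν₁_le K hK)) (Ne.symm h)
  have hκ0 : ∀ K, K ⊆ F → 0 ≤ κ K := by
    intro K hK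
    by_cases h : ν K = 0
    · simp only [hκ, h, if_true]; exact zero_le_one
    · simp only [hκ, h, if_false]; exact div_nonneg (hν₁_nonneg K hK) (hνpos K hK h).le
  have hκ1 : ∀ K, K ⊆ F → κ K ≤ 1 := by
    intro K hK
    by_cases h : ν K = 0
    · simp only [hκ, h, if_true, le_refl]
    · simp only [hκ, h, if_false]; exact (div_le_one (hνpos K hK h)).2 (hν₁_le K hK)
  have hκg : ∀ K, K ⊆ F → κ K * z K ≤ g K := by
    intro K hK
    by_cases h : ν K = 0
    · have hz : z K = 0 := hz0 K hK h
      have h1 : ν₁ K = 0 := le_antisymm (h ▸ hν₁_le K hK) (hν₁_nonneg K hK)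
      rw [hz, mul_zero, hg0 K hK h1]
    · simp only [hκ, h, if_false]
      rw [div_mul_eq_mul_div, div_le_iff₀ (hνpos K hK h)]
      calc ν₁ K * z K ≤ ν K * g K := hq K hK
        _ = g K * ν K := mul_comm _ _
  have hκmono : ∀ K K', K ⊆ K' → K' ⊆ F → κ K ≤ κ K' := by
    intro K K' hKK' hK'
    have hK : K ⊆ F := hKK'.trans hK'
    by_cases h' : ν K' = 0
    · simp only [hκ, h', if_true]; exact hκ1 K hK
    · by_cases h : ν K = 0
      · exact absurd (le_antisymm (h ▸ hν_anti K K' hKK' hK') ((hν₁_nonneg K' hK').trans (hν₁_le K' hK'))) h'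
      · simp only [hκ, h, h', if_false]
        rw [div_le_div_iff₀ (hνpos K hK h) (hνpos K' hK' h')]
        exact hmono K K' hKK' hK'
  -- the weight `λ`
  set lam : Finset α → ℝ := fun K => if K ∈ 𝒰₀ then 1 else if K ∈ 𝒰₁ then p * κ K else 0 with hlam
  have hlam0 : ∀ K ∈ F.powerset, 0 ≤ lam K := by
    intro K hK
    have hKF := Finset.mem_powerset.1 hK
    by_cases h0 : K ∈ 𝒰₀
    · simp only [hlam, h0, if_true]; exact zero_le_one
    · by_cases h1 : K ∈ 𝒰₁
      · simp only [hlam, h0, if_false, h1, if_true]; exact mul_nonneg hp0 (hκ0 K hKF)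
      · simp only [hlam, h0, h1, if_false, le_refl]
  have hlam_mono : ∀ K K', K ⊆ K' → K' ⊆ F → lam K ≤ lam K' := by
    intro K K' hKK' hK'
    have hK : K ⊆ F := hKK'.trans hK'
    by_cases h0 : K ∈ 𝒰₀
    · have h0' : K' ∈ 𝒰₀ := hup0 K h0 K' hKK' hK'
      simp only [hlam, h0, h0', if_true, le_refl]
    · by_cases h1 : K ∈ 𝒰₁
      · have h1' : K' ∈ 𝒰₁ := hup1 K h1 K' hKK' hK'
        by_cases h0' : K' ∈ 𝒰₀
        · simp only [hlam, h0, if_false, h1, h0', if_true]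
          calc p * κ K ≤ 1 * 1 := mul_le_mul hp1 (hκ1 K hK) (hκ0 K hK) zero_le_one
            _ = 1 := one_mul _
        · simp only [hlam, h0, h0', if_false, h1, h1', if_true]
          exact mul_le_mul_of_nonneg_left (hκmono K K' hKK' hK') hp0
      · simp only [hlam, h0, h1, if_false]
        exact hlam0 K' (Finset.mem_powerset.2 hK')
  -- step 1: lower bound by the `λ`-weighted un-glued sum
  have hstep : ∑ K ∈ F.powerset, lam K * z K ≤ ∑ K ∈ 𝒰₀, z K + p * ∑ K ∈ 𝒰₁ \ 𝒰₀, g K := by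
    have hsplit : ∑ K ∈ F.powerset, lam K * z K = ∑ K ∈ 𝒰₀, lam K * z K + ∑ K ∈ 𝒰₁ \ 𝒰₀, lam K * z K := by
      rw [← Finset.sum_subset h1F (fun K _ hK1 => by
        have hK0 : K ∉ 𝒰₀ := fun h => hK1 (h01 h)
        simp only [hlam, hK0, hK1, if_false, zero_mul])]
      rw [← Finset.sum_sdiff h01, add_comm]
    rw [hsplit]
    have hA : ∑ K ∈ 𝒰₀, lam K * z K = ∑ K ∈ 𝒰₀, z K :=
      Finset.sum_congr rfl fun K hK => by simp only [hlam, hK, if_true, one_mul]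
    have hB : ∑ K ∈ 𝒰₁ \ 𝒰₀, lam K * z K ≤ p * ∑ K ∈ 𝒰₁ \ 𝒰₀, g K := by
      rw [Finset.mul_sum]
      refine Finset.sum_le_sum fun K hK => ?_
      obtain ⟨hK1, hK0⟩ := Finset.mem_sdiff.1 hK
      have hKF := Finset.mem_powerset.1 (h1F hK1)
      simp only [hlam, hK0, if_false, hK1, if_true]
      rw [mul_assoc]
      exact mul_le_mul_of_nonneg_left (hκg K hKF) hp0
    rw [hA]
    linarith
  refine le_trans ?_ hstep
  -- step 2: layer cake over the level sets, which are up-closed families of nonempty patterns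
  refine al5lc_layerCake F.powerset z lam hlam0 fun c hc => ?_
  refine hUPS _ (Finset.filter_subset _ _) ?_ ?_
  · intro K hK
    obtain ⟨hKP, hKc⟩ := Finset.mem_filter.1 hK
    have hK1 : K ∈ 𝒰₁ := by
      by_contra h1
      have h0 : K ∉ 𝒰₀ := fun h => h1 (h01 h)
      simp only [hlam, h0, h1, if_false] at hKc
      linarith
    exact hne K hK1
  · intro K hK K' hKK' hK'
    obtain ⟨hKP, hKc⟩ := Finset.mem_filter.1 hK
    exact Finset.mem_filter.2 ⟨Finset.mem_powerset.2 hK', hKc.trans (hlam_mono K K' hKK' hK')⟩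

end AL5LayerCake

end

end Summit.CriticalPhenomena.PercolationContinuityZ3.Theorems
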